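import Mathlib
import Summits.ValiantsHypothesis.ValiantsHypothesis.Theorems.BarrierLeverPartitionMinorsHitByVPHiddenStatesTropical

/-!
# Route BarrierLever — item `PartitionMinorsHitByVP` (stmt-ValiantsHypothesis-19717), line `hidden_states`:
# THE SIGNED TROPICAL CERTIFICATE — a non-cancelling SIGNED COUNT of optimal assignments forces a nonsingular block-additive matrix

Helper file (`--supports stmt-ValiantsHypothesis-19717`; cell valiant-natproofs, rung V4, 𝒟-side door (c), line
`Cruxes/PartitionMinorsHitByVP/Lines/hidden_states.lean` v9; prover seat val-np-p3 gen 17). One bookkeeping `def` (`attain`); an ENGINE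
extending `…HiddenStatesTropical` (p579287, `Tropical.det_ne_zero_of_unique_assignment`). Closes NO item.

WHY. The unique-optimal-assignment certificate is NOT universal: for the GOOD instance `𝒰 = B₁(5) ∪ K_{1,4}` against the flat design on
`K = 6` states no monomial of the design determinant comes from a unique term (val-np-p3 g17 memo §3b, exhaustive over 8 363 520 terms),
while the certificates that DO exist in the censuses of this seat (home-bijection lex directions, memo §3c–§3e; e.g. the full cube `2^[4]`
against `B₂(5)`: 53 optimal assignments with signed count `−1`) are SIGNED COUNTS. This file upgrades the engine accordingly.

* `attain w x a` — the number of attainers of the tropical coordinate `μ_x(a)` (the base weight and/or states of `J`); it is the leading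
  coefficient of the affine functional polynomial `linPoly w x a` (`leadingCoeff_linPoly`), so the Leibniz term of a permutation `σ` has
  leading coefficient `∏_k ∏_{a ∈ u (σ k)} attain w (e k) a` (`leadingCoeff_term`).
* `coeff_det_tropM` — for any `D` bounding every assignment cost from above, the coefficient of `X^D` in `det (tropM w u e)` is the SIGNED,
  attainer-weighted count `Σ_{σ : cost(σ) = D} sign σ · ∏_k ∏_a attain` (terms of smaller cost do not reach degree `D`).
* `det_ne_zero_of_signed_count` — if that integer is nonzero, the power table `N^{w}` for a suitable `N` makes the block-additive matrix
  `[∏_{a ∈ u i}(tx (e k).1 none a + Σ_{q ∈ (e k).2} tx (e k).1 (some q) a)]` nonsingular; `det_ne_zero_of_signed_count_sharp` — when every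
  maximum is attained ONCE (`attain = 1`, e.g. pairwise distinct weights per coordinate), the hypothesis is just `Σ_{σ optimal} sign σ ≠ 0`.
  `det_ne_zero_of_unique_assignment` is the special case of a single optimal `σ`.

WHAT THIS IS NOT: a sufficient condition; no family is certified here; item 19717 OPEN; nothing on crux 14610 or VP ≠ VNP.
-/

set_option linter.dupNamespace false

namespace Summit.ValiantsHypothesis.ValiantsHypothesis.Theorems.BarrierLever.HiddenStates

open Finset Matrix Polynomial

noncomputable section

namespace Tropical

variable {h m K r : ℕ}

/-- The number of attainers of the tropical coordinate `μ_x(a)`: the base weight (if maximal) plus the states of `J` of maximal weight. -/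
def attain (w : Fin m → Option (Fin K) → Fin h → ℕ) (x : Fin m × Finset (Fin K)) (a : Fin h) : ℕ :=
  (if w x.1 none a = mu w x a then 1 else 0) + #(x.2.filter fun q => w x.1 (some q) a = mu w x a)

/-- The leading coefficient of the affine functional polynomial counts the attainers. -/
theorem leadingCoeff_linPoly (w : Fin m → Option (Fin K) → Fin h → ℕ) (x : Fin m × Finset (Fin K)) (a : Fin h) :
    (linPoly w x a).leadingCoeff = (attain w x a : ℤ) := by
  classical
  rw [Polynomial.leadingCoeff, natDegree_linPoly, coeff_linPoly, attain]
  push_cast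
  congr 1
  · simp only [eq_comm]
  · rw [Finset.natCast_card_filter]
    refine Finset.sum_congr rfl fun q _ => ?_
    simp only [eq_comm]

/-- The leading coefficient of an entry is the product of the attainer counts. -/
theorem leadingCoeff_entryPoly (w : Fin m → Option (Fin K) → Fin h → ℕ) (U : Finset (Fin h)) (x : Fin m × Finset (Fin K)) :
    (entryPoly w U x).leadingCoeff = ∏ a ∈ U, (attain w x a : ℤ) := by
  unfold entryPoly
  rw [Polynomial.leadingCoeff_prod]
  exact Finset.prod_congr rfl fun a _ => leadingCoeff_linPoly w x a

/-- The leading coefficient of the Leibniz term of `σ`. -/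
theorem leadingCoeff_term (w : Fin m → Option (Fin K) → Fin h → ℕ) (u : Fin r → Finset (Fin h))
    (e : Fin r → Fin m × Finset (Fin K)) (σ : Equiv.Perm (Fin r)) :
    (∏ k, tropM w u e (σ k) k).leadingCoeff = ∏ k, ∏ a ∈ u (σ k), (attain w (e k) a : ℤ) := by
  rw [Polynomial.leadingCoeff_prod]
  exact Finset.prod_congr rfl fun k _ => leadingCoeff_entryPoly w (u (σ k)) (e k)

/-- **The top coefficient of the tropical determinant is the signed attainer-weighted count of the optimal assignments.** For every
`D` with `cost(σ) ≤ D` for all `σ`, `coeff (det tropM) D = Σ_{σ : cost(σ) = D} sign σ · ∏_k ∏_{a ∈ u (σ k)} attain w (e k) a`. -/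
theorem coeff_det_tropM (w : Fin m → Option (Fin K) → Fin h → ℕ) (u : Fin r → Finset (Fin h))
    (e : Fin r → Fin m × Finset (Fin K)) (D : ℕ) (hD : ∀ σ : Equiv.Perm (Fin r), ∑ k, cost w (u (σ k)) (e k) ≤ D) :
    (tropM w u e).det.coeff D =
      ∑ σ : Equiv.Perm (Fin r), if ∑ k, cost w (u (σ k)) (e k) = D then
        ((Equiv.Perm.sign σ : ℤˣ) : ℤ) * ∏ k, ∏ a ∈ u (σ k), (attain w (e k) a : ℤ) else 0 := by
  classical
  rw [Matrix.det_apply', Polynomial.finsetSum_coeff]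
  refine Finset.sum_congr rfl fun σ _ => ?_
  rw [← Polynomial.C_eq_intCast, Polynomial.coeff_C_mul]
  by_cases hσ : ∑ k, cost w (u (σ k)) (e k) = D
  · rw [if_pos hσ]
    congr 1
    have hnd : (∏ k, tropM w u e (σ k) k).natDegree = D := by rw [natDegree_term, hσ]
    rw [← hnd, Polynomial.coeff_natDegree, leadingCoeff_term]
  · rw [if_neg hσ]
    have hlt : (∏ k, tropM w u e (σ k) k).natDegree < D := by
      rw [natDegree_term]; exact lt_of_le_of_ne (hD σ) hσ
    rw [Polynomial.coeff_eq_zero_of_natDegree_lt hlt, mul_zero]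

/-- **The signed tropical determinant lemma.** If the signed attainer-weighted count of the cost-`D` assignments is nonzero (with `D` an
upper bound for all costs, i.e. the optimal value when attained), the tropical determinant is a nonzero polynomial. -/
theorem det_tropM_ne_zero_of_signed (w : Fin m → Option (Fin K) → Fin h → ℕ) (u : Fin r → Finset (Fin h))
    (e : Fin r → Fin m × Finset (Fin K)) (D : ℕ) (hD : ∀ σ : Equiv.Perm (Fin r), ∑ k, cost w (u (σ k)) (e k) ≤ D)
    (hne : (∑ σ : Equiv.Perm (Fin r), if ∑ k, cost w (u (σ k)) (e k) = D then
        ((Equiv.Perm.sign σ : ℤˣ) : ℤ) * ∏ k, ∏ a ∈ u (σ k), (attain w (e k) a : ℤ) else 0) ≠ 0) :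
    (tropM w u e).det ≠ 0 := by
  intro h0
  apply hne
  rw [← coeff_det_tropM w u e D hD, h0, Polynomial.coeff_zero]

/-- **SIGNED TROPICAL CERTIFICATE.** Same shape as `det_ne_zero_of_unique_assignment`, with the uniqueness of the optimal assignment
replaced by the non-vanishing of the signed attainer-weighted count of the optimal assignments. -/
theorem det_ne_zero_of_signed_count (u : Fin r → Finset (Fin h)) (e : Fin r → Fin m × Finset (Fin K))
    (w : Fin m → Option (Fin K) → Fin h → ℕ) (D : ℕ) (hD : ∀ σ : Equiv.Perm (Fin r), ∑ k, cost w (u (σ k)) (e k) ≤ D)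
    (hne : (∑ σ : Equiv.Perm (Fin r), if ∑ k, cost w (u (σ k)) (e k) = D then
        ((Equiv.Perm.sign σ : ℤˣ) : ℤ) * ∏ k, ∏ a ∈ u (σ k), (attain w (e k) a : ℤ) else 0) ≠ 0) :
    ∃ tx : Fin m → Option (Fin K) → Fin h → ℂ,
      (Matrix.of fun i k : Fin r =>
        ∏ a ∈ u i, (tx (e k).1 none a + ∑ q ∈ (e k).2, tx (e k).1 (some q) a)).det ≠ 0 := by
  classical
  obtain ⟨N, hN⟩ := exists_nat_eval_ne_zero (det_tropM_ne_zero_of_signed w u e D hD hne)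
  refine ⟨fun p o a => (N : ℂ) ^ (w p o a), ?_⟩
  let φ : ℤ[X] →+* ℂ := Polynomial.eval₂RingHom (Int.castRingHom ℂ) (N : ℂ)
  have hmat : (Matrix.of fun i k : Fin r =>
      ∏ a ∈ u i, ((N : ℂ) ^ (w (e k).1 none a) + ∑ q ∈ (e k).2, (N : ℂ) ^ (w (e k).1 (some q) a)))
        = φ.mapMatrix (tropM w u e) := by
    ext i k
    simp only [RingHom.mapMatrix_apply, Matrix.map_apply, Matrix.of_apply, tropM, entryPoly, linPoly, map_prod,
      map_add, map_sum, map_pow]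
    simp [φ]
  rw [hmat, ← RingHom.map_det]
  have hφ : φ (tropM w u e).det = (((tropM w u e).det.eval (N : ℤ) : ℤ) : ℂ) := by
    simp [φ, Polynomial.eval₂_at_natCast]
  rw [hφ]
  exact_mod_cast hN

/-- **Sharp weights.** If every tropical maximum is attained exactly once (e.g. all weights at a fixed coordinate pairwise distinct), the
attainer products are `1` and the certificate is the plain signed count of the optimal assignments. -/
theorem det_ne_zero_of_signed_count_sharp (u : Fin r → Finset (Fin h)) (e : Fin r → Fin m × Finset (Fin K))
    (w : Fin m → Option (Fin K) → Fin h → ℕ) (hsharp : ∀ k a, attain w (e k) a = 1)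
    (D : ℕ) (hD : ∀ σ : Equiv.Perm (Fin r), ∑ k, cost w (u (σ k)) (e k) ≤ D)
    (hne : (∑ σ : Equiv.Perm (Fin r), if ∑ k, cost w (u (σ k)) (e k) = D then ((Equiv.Perm.sign σ : ℤˣ) : ℤ) else 0) ≠ 0) :
    ∃ tx : Fin m → Option (Fin K) → Fin h → ℂ,
      (Matrix.of fun i k : Fin r =>
        ∏ a ∈ u i, (tx (e k).1 none a + ∑ q ∈ (e k).2, tx (e k).1 (some q) a)).det ≠ 0 := by
  refine det_ne_zero_of_signed_count u e w D hD ?_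
  have hprod : ∀ σ : Equiv.Perm (Fin r), ∏ k, ∏ a ∈ u (σ k), (attain w (e k) a : ℤ) = 1 := by
    intro σ
    refine Finset.prod_eq_one fun k _ => Finset.prod_eq_one fun a _ => ?_
    rw [hsharp k a]; simp
  simp_rw [hprod, mul_one]
  exact hne

end Tropical

end

end Summit.ValiantsHypothesis.ValiantsHypothesis.Theorems.BarrierLever.HiddenStates
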